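import Literature.NumberTheory.Transcendental.KZLogCalculusProofs

/-!
# `UnfoldedLogStokes` (stmt-KontsevichZagierPeriods-2835) — line `engine-transport`,
stub `stub_foldIntegrable` (T1, folding integrability)

Tonelli read-off used by the engine of route `LiouvilleUnfolding`: if the UNFOLDED monomial
`(x,u) ↦ h x / u` is absolutely integrable on the band `{x ∈ σ, 1 ≤ u ≤ v x}` (the integrand `g` being
pinned to `h x / u` only off a null set `N` of the base), then the FOLDED monomial `h · log v` is
integrable on `σ`. Proof: transfer to `ℝ × ℝⁿ` by `MeasureTheory.volume_preserving_piFinSuccAbove`,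
`MeasureTheory.Integrable.integral_norm_prod_right` (Tonelli), and the fibre integral
`∫_{[1, v]} |h|/u du = |h| log v` (`KZlog.integral_div_Icc_one`). [folklore]
-/

noncomputable section

open MeasureTheory Set
open Literature.NumberTheory.Transcendental
open Literature.ModelTheory.ExponentialFields (IsSemialgebraic)

namespace Summit.KontsevichZagierPeriods.LiouvilleUnfolding.Engine

/-- **Stub T1 — folding integrability (Tonelli read-off).** If the unfolded monomial
`(x,u) ↦ h x / u` is absolutely integrable on `{x ∈ σ, 1 ≤ u ≤ v x}` (pinned off a null set `N` of
the base), then `h · log v ∈ L¹(σ)`: `∫₁^v |h|/u du = |h| log v` fibrewise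
(`KZlog.integral_div_Icc_one`) and Tonelli along the last coordinate
(`MeasureTheory.Integrable.integral_norm_prod_right` after `volume_preserving_piFinSuccAbove`).
[folklore] -/
theorem stub_foldIntegrable : ∀ (n : ℕ) (σ N : Set (Fin n → ℝ)) (h v : (Fin n → ℝ) → ℝ) (g : (Fin (n + 1) → ℝ) → ℝ), Literature.ModelTheory.ExponentialFields.IsSemialgebraic ℚ σ → Literature.NumberTheory.Transcendental.IsSemialgebraicFunOn ℚ σ h → Literature.NumberTheory.Transcendental.IsSemialgebraicFunOn ℚ σ v → (∀ x ∈ σ, 1 ≤ v x) → MeasureTheory.volume N = 0 → MeasureTheory.IntegrableOn g (Literature.NumberTheory.Transcendental.KZlog.band σ (fun _ => 1) v) → (∀ z ∈ Literature.NumberTheory.Transcendental.KZlog.band σ (fun _ => 1) v, Fin.init z ∉ N → g z = h (Fin.init z) / z (Fin.last n)) → MeasureTheory.IntegrableOn (fun x => h x * Real.log (v x)) σ := by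
  intro n σ N h v g hσ hh hv hv1 hN0 hg hpin
  have hσm : MeasurableSet σ := IsSemialgebraic.measurableSet_holds hσ
  have hBsa : IsSemialgebraic ℚ (KZlog.band σ (fun _ => (1 : ℝ)) v) :=
    KZlog.isSemialgebraic_band (by simpa using isSemialgebraicFunOn_ratCast hσ 1) hv
  have hBm : MeasurableSet (KZlog.band σ (fun _ => (1 : ℝ)) v) :=
    IsSemialgebraic.measurableSet_holds hBsa
  -- the integrand extended by zero, and its transfer to `ℝ × ℝⁿ`
  set G : (Fin (n + 1) → ℝ) → ℝ := (KZlog.band σ (fun _ => (1 : ℝ)) v).indicator g with hG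
  have hGint : Integrable G := (integrable_indicator_iff hBm).2 hg
  set e : (Fin (n + 1) → ℝ) ≃ᵐ ℝ × (Fin n → ℝ) :=
    MeasurableEquiv.piFinSuccAbove (fun _ => ℝ) (Fin.last n) with he_def
  have he : MeasurePreserving e volume volume :=
    volume_preserving_piFinSuccAbove (fun _ => ℝ) (Fin.last n)
  have he_symm : ∀ p : ℝ × (Fin n → ℝ), e.symm p = Fin.snoc p.2 p.1 := fun p => by
    simp [he_def, MeasurableEquiv.piFinSuccAbove, Fin.snocEquiv]
  have hG2 : Integrable (fun p : ℝ × (Fin n → ℝ) => G (Fin.snoc p.2 p.1))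
      ((volume : Measure ℝ).prod (volume : Measure (Fin n → ℝ))) := by
    have h := ((he.symm e).integrable_comp_emb e.symm.measurableEmbedding (g := G)).mpr hGint
    rw [← Measure.volume_eq_prod]
    convert h using 1
    ext p
    simp [he_symm]
  -- Tonelli: the fibre integrals of the norm are integrable
  have hnorm : Integrable (fun x : Fin n → ℝ => ∫ t : ℝ, ‖G (Fin.snoc x t)‖) := by
    simpa using hG2.integral_norm_prod_right
  -- the fibre integral off `N` is `|h| log v`
  have hfib : ∀ x ∈ σ, x ∉ N → ∫ t : ℝ, ‖G (Fin.snoc x t)‖ = |h x| * Real.log (v x) := by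
    intro x hx hxN
    have hfun : (fun t => ‖G (Fin.snoc x t)‖) = (Icc 1 (v x)).indicator (fun t => |h x| / t) := by
      ext t
      by_cases ht : t ∈ Icc 1 (v x)
      · have hmem : (Fin.snoc x t : Fin (n + 1) → ℝ) ∈ KZlog.band σ (fun _ => (1 : ℝ)) v :=
          KZlog.snoc_mem_band.2 ⟨hx, ht⟩
        rw [indicator_of_mem ht, hG, indicator_of_mem hmem, hpin _ hmem (by simpa using hxN)]
        simp only [Fin.init_snoc, Fin.snoc_last, Real.norm_eq_abs, abs_div,
          abs_of_pos (one_pos.trans_le ht.1)]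
      · rw [indicator_of_notMem ht, hG,
          indicator_of_notMem (fun hmem => ht (KZlog.snoc_mem_band.1 hmem).2), norm_zero]
    rw [hfun, integral_indicator measurableSet_Icc, KZlog.integral_div_Icc_one _ _ (hv1 x hx)]
  -- hence `|h| log v ∈ L¹(σ)`
  have hint_abs : IntegrableOn (fun x => |h x| * Real.log (v x)) σ := by
    refine hnorm.integrableOn.congr_fun_ae ?_
    filter_upwards [ae_restrict_of_ae (compl_mem_ae_iff.2 hN0), ae_restrict_mem hσm] with x hxN hx
    exact hfib x hx hxN
  -- and `h log v ∈ L¹(σ)` (same norm, measurable)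
  have hmeas : AEStronglyMeasurable (fun x => h x * Real.log (v x)) (volume.restrict σ) := by
    have h1 : AEStronglyMeasurable h (volume.restrict σ) :=
      KZ.aestronglyMeasurable_of_isSemialgebraicFunOn hh hσm
    have h2 : AEStronglyMeasurable v (volume.restrict σ) :=
      KZ.aestronglyMeasurable_of_isSemialgebraicFunOn hv hσm
    exact h1.mul (Real.measurable_log.comp_aemeasurable h2.aemeasurable).aestronglyMeasurable
  refine Integrable.mono' hint_abs hmeas ?_
  filter_upwards [ae_restrict_mem hσm] with x hx
  rw [norm_mul, Real.norm_eq_abs, Real.norm_eq_abs, abs_of_nonneg (Real.log_nonneg (hv1 x hx))]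

end Summit.KontsevichZagierPeriods.LiouvilleUnfolding.Engine
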